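import Summits.CriticalPhenomena.Ising3DConformalLimit.Theorems.MonotoneBlockingNonSeparableModulusAxialPincer
import Summits.CriticalPhenomena.Ising3DConformalLimit.Theorems.NonSeparableModulus.Negative.NecessaryForSummit
import HarnessLib

/-!
# `NonSeparableModulus` (stmt-CriticalPhenomena-6152): exact refutation criterion and redundancy of the separability restriction

Negative knowledge about the crux `…Theses.MonotoneBlocking.NonSeparableModulus` (NS), standing crux
disprover (D-0016); THEOREM-ONLY (no definitions), supports the item, closes nothing. Corollaries of the
lead's landed axial pincer (`MonotoneBlockingNonSeparableModulusAxialPincer.twoPointDoubling_of_nonSeparableModulus`,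
p159449: NS ⟹ item 6150) combined with `Negative/NecessaryForSummit.lean` (6150 ⟹ restriction-free
one-point modulus ⟹ NS; Summit ⟹ NS).

* `not_nonSeparableModulus_iff_doubling_fails` — **the exact refutation criterion**: `¬NS` holds iff
  all-scale axial doubling of `g(n) = ⟨σ₀σ_{ne₀}⟩_{β_c(3)}` fails, i.e. iff for every `κ > 0` there is a
  scale `n ≥ 1` with `g(2n) < κ g(n)`. A disprover of this crux must therefore produce scales with
  `g(2n_k)/g(n_k) → 0` for the ACTUAL critical two-point function — nothing about caged configurations,
  nine-normals or `n`-point functions is involved any more. The catalogued axis facts do not decide it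
  (`Literature.Barriers.CriticalPhenomena.AxisProfileAxiomaticsNoDoubling`); numerics give
  `g(2n)/g(n) → 2^{-(1+η)} ≈ 0.488`; and by `not_summit_of_not_nonSeparableModulus` any such witness
  refutes the conjunct `Ising3DConformalLimit`.
* `onePointModulus_of_nonSeparableModulus` — **the `¬ m-separable` restriction is provably redundant**:
  NS implies the restriction-free one-point modulus at EVERY configuration (through 6150 and
  `UniformRegularity`), so the restriction carries no information a prover could exploit.

References: Aizenman–Duminil-Copin 2021, Remark 5.10 [AizenmanDuminilCopinAnnals2021].
-/

noncomputable section

namespace Summit.CriticalPhenomena.Ising3DConformalLimit.NonSeparableModulusNegative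

open Literature.Probability.LatticeModels
open Summit.CriticalPhenomena.Ising3DConformalLimit.Theses
open Summit.CriticalPhenomena.Ising3DConformalLimit.MonotoneBlockingNonSeparableModulusAxialPincer
  (twoPointDoubling_of_nonSeparableModulus)

/-- **Exact refutation criterion for the crux**: `¬NS ↔` axial doubling fails at some scale for every
ratio `κ > 0`. [cite: AizenmanDuminilCopinAnnals2021, Remark 5.10] -/
theorem not_nonSeparableModulus_iff_doubling_fails :
    ¬ MonotoneBlocking.NonSeparableModulus ↔
      ∀ κ : ℝ, 0 < κ → ∃ n : ℕ, 1 ≤ n ∧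
        criticalTwoPoint 3 (Pi.single 0 (2 * (n : ℤ))) < κ * criticalTwoPoint 3 (Pi.single 0 (n : ℤ)) := by
  refine ⟨doubling_fails_of_not_nonSeparableModulus, fun h hNS => ?_⟩
  obtain ⟨κ, hκ, hD⟩ := twoPointDoubling_of_nonSeparableModulus hNS
  obtain ⟨n, hn, hlt⟩ := h κ hκ
  exact absurd (hD n hn) (not_le.2 hlt)

/-- The same criterion for the `MirrorHoelderCompactness` copy of the crux. [folklore] -/
theorem not_mirror_nonSeparableModulus_iff_doubling_fails :
    ¬ MirrorHoelderCompactness.NonSeparableModulus ↔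
      ∀ κ : ℝ, 0 < κ → ∃ n : ℕ, 1 ≤ n ∧
        criticalTwoPoint 3 (Pi.single 0 (2 * (n : ℤ))) < κ * criticalTwoPoint 3 (Pi.single 0 (n : ℤ)) :=
  not_nonSeparableModulus_iff_doubling_fails

/-- **The separability restriction is redundant**: NS implies the one-point modulus at EVERY
configuration of every compact `K ⊆ NonCoincident` (the crux with the hypothesis
"`(x, i)` not `m`-separable" deleted), via NS ⟹ 6150 ⟹ 4658. [folklore] -/
theorem onePointModulus_of_nonSeparableModulus (h : MonotoneBlocking.NonSeparableModulus) :
    ∀ (n : ℕ) (K : Set (Fin n → EuclideanSpace ℝ (Fin 3))), K ⊆ NonCoincident 3 n → IsCompact K →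
      ∀ ε : ℝ, 0 < ε → ∃ η δ₀ : ℝ, 0 < η ∧ 0 < δ₀ ∧ ∀ δ ∈ Set.Ioo 0 δ₀, ∀ x ∈ K,
      ∀ (i : Fin n) (y : EuclideanSpace ℝ (Fin 3)), ‖y - x i‖ < η →
        |rescaledCorrelator (criticalCorr 3)
            (fun δ : ℝ => (criticalTwoPoint 3 (Pi.single 0 ⌊δ⁻¹⌋)) ^ (-(1/2:ℝ))) n δ
            (Function.update x i y) -
          rescaledCorrelator (criticalCorr 3)
            (fun δ : ℝ => (criticalTwoPoint 3 (Pi.single 0 ⌊δ⁻¹⌋)) ^ (-(1/2:ℝ))) n δ x| < ε :=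
  onePointModulus_of_twoPointDoubling (twoPointDoubling_of_nonSeparableModulus h)

end Summit.CriticalPhenomena.Ising3DConformalLimit.NonSeparableModulusNegative

end
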